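import Literature.AlgebraicGeometry.Resolution.KollarBoundarySeparationTameSurface
import Literature.AlgebraicGeometry.Resolution.SigmaMaxEliminationInDim
import HarnessLib

/-!
# Kollár's 3.103 Step 1 on a surface in the tame regime: moving the cosupport off ALL boundary curves (Kollár 2007, Lemma 3.102 iterated)

Topic: `Literature/AlgebraicGeometry/Resolution`. J. Kollár, *Lectures on Resolution of
Singularities* (2007), proof of Thm. 3.103 / 3.104 Step 2.1 (p. 172 of the held copy): the
functors `𝓑𝓓_{n,m,j}` of Lemma 3.102 are applied one after the other to the members `E^1, …, E^s`
of the boundary — "at its end `cosupp(I_r, m) ∩ Π_*^{-1}E = ∅`" (the tree's characteristic-zero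
functor: `Kollar2007.bdFold`, `KollarBoundaryFold.lean`). This file PROVES the existence
statement in dimension two and characteristic `p > b` by iterating
`Kollar2007.exists_separate_boundary_member` (`KollarBoundarySeparationTameSurface.lean`), with
the bookkeeping that a divisor once disjoint from the cosupport stays disjoint
(`CentreSeq.transformDivisor_disjoint_of_disjoint`) and that the standing hypotheses (smooth
over the perfect field, Noetherian of dimension `≤ 2`) pass to the top of any blow-up sequence:

* `CentreSeq.noetherianSpace_top` — the top of a blow-up sequence over a Noetherian scheme is a
  Noetherian space (proper over a quasi-compact locally Noetherian scheme);
* **`Kollar2007.exists_separate_boundary`** — for `X` smooth over a perfect field of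
  characteristic `p` (`p = 0` allowed), Noetherian of dimension `≤ 2`, `(I, E, b)` with `E` snc,
  `1 ≤ b < p`: a blow-up sequence `t` admissible for `(X, I, E, b)` at whose top the cosupport is
  disjoint from the birational transform of EVERY member of `E`.

## Sources

* J. Kollár, *Lectures on Resolution of Singularities*, Ann. of Math. Stud. 166 (2007):
  Lemma 3.102, proof of Thm. 3.103, 3.104 Step 2.1 (pp. 169–172). [Kollar2007]
* E. Bierstone, D. Grigoriev, P. Milman, J. Włodarczyk, arXiv:1206.3090: Def. 3.1.3,
  Thm. 8.0.4. [BierstoneGrigorievMilmanWlodarczyk2011]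
* H. Matsumura, *Commutative Ring Theory* (1986), Thm. 15.5 — via `BlowupReducedDimension.lean`.
  [Matsumura1987]
-/

noncomputable section

open CategoryTheory CategoryTheory.Limits AlgebraicGeometry TopologicalSpace IsLocalRing
  Scheme.IdealSheafData

namespace Literature.AlgebraicGeometry.Resolution

universe u

/-! ## Standing hypotheses along a blow-up sequence -/

namespace CentreSeq

/-- **The top of a blow-up sequence over a Noetherian scheme is a Noetherian topological space**
(the composite is proper, hence quasi-compact, and the top is locally Noetherian).
[cite: StacksProject, Tag 01OZ] -/
theorem noetherianSpace_top {X : Scheme.{u}} [IsLocallyNoetherian X] [NoetherianSpace X]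
    (t : CentreSeq X) : NoetherianSpace t.top := by
  haveI : IsProper t.comp := t.isProper_comp
  haveI : CompactSpace X := NoetherianSpace.compactSpace X
  haveI : CompactSpace t.top := QuasiCompact.compactSpace_of_compactSpace t.comp
  haveI : IsLocallyNoetherian t.top := LocallyOfFiniteType.isLocallyNoetherian t.comp
  haveI : IsNoetherian t.top := {}
  infer_instance

end CentreSeq

/-! ## Separation from all members -/

namespace Kollar2007

variable (k : Type u) [Field k]

/-- **Kollár's 3.103 Step 1 on a surface, tame regime — all members, with a bound on their
number** (induction on the number of members still to be separated: separate one by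
`exists_separate_boundary_member`, continue on the top of that sequence with the birational
transforms of the remaining ones; a member already disjoint from the cosupport stays disjoint).
[cite: Kollar2007, Lemma 3.102, proof of Thm. 3.103 (pp. 169–172)]
[cite: BierstoneGrigorievMilmanWlodarczyk2011, Thm. 8.0.4] -/
theorem exists_separate_boundary_aux (p : ℕ) [CharP k p] [PerfectField k] :
    ∀ (n : ℕ) (X : Scheme.{u}) (f : X ⟶ Spec (.of k)) [Smooth f] [NoetherianSpace X],
      topologicalKrullDim X ≤ 2 →
      ∀ (I : X.IdealSheafData) (E L : List X.IdealSheafData) {b : ℕ}, 1 ≤ b → (p = 0 ∨ b < p) →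
      HasSNC E → (∀ D ∈ L, D ∈ E) → L.length ≤ n →
      ∃ t : CentreSeq X, t.IsAdmissibleFor ⟨I, E, b⟩ ∧
        ∀ D ∈ L, ((t.transformDivisor D).support : Set t.top) ∩ (t.transformMarked ⟨I, E, b⟩).support = ∅ := by
  intro n
  induction n with
  | zero =>
    intro X f _ _ hX2 I E L b hb hbp hE hLE hn
    have hL : L = [] := List.eq_nil_of_length_eq_zero (Nat.le_zero.mp hn)
    exact ⟨CentreSeq.nil X, trivial, fun D hD => by rw [hL] at hD; simp at hD⟩
  | succ n ih =>
    intro X f _ _ hX2 I E L b hb hbp hE hLE hn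
    letI : X.Over (Spec (.of k)) := ⟨f⟩
    haveI : Smooth (X ↘ Spec (.of k)) := inferInstanceAs (Smooth f)
    haveI : IsLocallyNoetherian X := isLocallyNoetherian_of_locallyOfFiniteType_over k X
    have hXreg : Scheme.IsRegular X := Scheme.isRegular_of_smooth_over_field k X
    set M : MarkedIdeal X := ⟨I, E, b⟩ with hM
    cases L with
    | nil => exact ⟨CentreSeq.nil X, trivial, fun D hD => by simp at hD⟩
    | cons D L' =>
      have hD : D ∈ E := hLE D (by simp)
      -- separate `D`
      obtain ⟨t₁, ht₁, hsep₁⟩ := exists_separate_boundary_member k X p hX2 I hE hb hbp hD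
      -- the top of `t₁`
      haveI : IsProper t₁.comp := t₁.isProper_comp
      haveI : IsLocallyNoetherian t₁.top := LocallyOfFiniteType.isLocallyNoetherian t₁.comp
      have hX₁reg : Scheme.IsRegular t₁.top :=
        (CentreSeq.IsAdmissibleFor.isMultipleBlowup t₁ M ht₁).isRegular hXreg
      haveI : Smooth (t₁.comp ≫ f) := smooth_of_isRegular_of_perfectField _ hX₁reg
      haveI : NoetherianSpace t₁.top := t₁.noetherianSpace_top
      have hX₁2 : topologicalKrullDim t₁.top ≤ 2 := t₁.topologicalKrullDim_top_le (N := 2) hX2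
      set M₁ : MarkedIdeal t₁.top := t₁.transformMarked M with hM₁
      have hM₁eq : (⟨M₁.ideal, M₁.boundary, b⟩ : MarkedIdeal t₁.top) = M₁ := by
        rw [show b = M₁.mult from (CentreSeq.transformMarked_mult t₁ M).symm]
      have hE₁ : HasSNC M₁.boundary := CentreSeq.IsAdmissibleFor.hasSNC_transformMarked_boundary t₁ M ht₁ hE
      -- the remaining members, transformed
      set L₁ : List t₁.top.IdealSheafData := L'.map t₁.transformDivisor with hL₁
      have hL₁E : ∀ D₁ ∈ L₁, D₁ ∈ M₁.boundary := by
        intro D₁ hD₁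
        obtain ⟨D', hD', rfl⟩ := List.mem_map.mp hD₁
        rw [hM₁, CentreSeq.transformMarked_boundary]
        exact List.mem_append_left _ (List.mem_map.mpr ⟨D', hLE D' (List.mem_cons_of_mem D hD'), rfl⟩)
      have hn₁ : L₁.length ≤ n := by
        rw [hL₁, List.length_map]
        have : (D :: L').length = L'.length + 1 := rfl
        omega
      obtain ⟨t₂, ht₂, hsep₂⟩ := ih t₁.top (t₁.comp ≫ f) hX₁2 M₁.ideal M₁.boundary L₁ hb hbp hE₁ hL₁E hn₁
      rw [hM₁eq] at ht₂ hsep₂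
      refine ⟨t₁.append t₂, (CentreSeq.isAdmissibleFor_append_iff t₁ t₂ M).mpr ⟨ht₁, ht₂⟩, ?_⟩
      intro D' hD'
      rcases List.mem_cons.mp hD' with rfl | hD'L
      · exact CentreSeq.support_inter_transformDivisor_append t₁ t₂ _ M
          (CentreSeq.transformDivisor_disjoint_of_disjoint t₂ _ M₁ ht₂ (hsep₁))
      · exact CentreSeq.support_inter_transformDivisor_append t₁ t₂ _ M
          (hsep₂ _ (List.mem_map.mpr ⟨D', hD'L, rfl⟩))

/-- **Kollár's 3.103 Step 1 on a surface in the tame regime: moving the cosupport off the whole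
boundary.** Let `X` be smooth over a perfect field `k` of characteristic `p` (`p = 0` allowed),
Noetherian of dimension `≤ 2`, and `(I, E, b)` a marked ideal with `E` a simple normal crossing
boundary, `1 ≤ b` and `p = 0 ∨ b < p`. Then there is a blow-up sequence `t` admissible for
`(X, I, E, b)` (BGMW Def. 3.1.3) such that at its top the cosupport `cosupp(I_r, b)` is disjoint
from the birational transform `t_*^{-1} D` of every member `D` of `E`: "cosupp(I_r, m) ∩
Π_*^{-1} E = ∅". [cite: Kollar2007, Lemma 3.102, Thm. 3.103 (proof), 3.104 Step 2.1 (pp. 169–172)]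
[cite: BierstoneGrigorievMilmanWlodarczyk2011, Def. 3.1.3, Thm. 8.0.4] -/
theorem exists_separate_boundary (X : Scheme.{u}) [X.Over (Spec (.of k))] (p : ℕ) [CharP k p]
    [PerfectField k] [Smooth (X ↘ Spec (.of k))] [NoetherianSpace X]
    (hX2 : topologicalKrullDim X ≤ 2) (I : X.IdealSheafData) {E : List X.IdealSheafData}
    (hE : HasSNC E) {b : ℕ} (hb : 1 ≤ b) (hbp : p = 0 ∨ b < p) :
    ∃ t : CentreSeq X, t.IsAdmissibleFor ⟨I, E, b⟩ ∧
      ∀ D ∈ E, ((t.transformDivisor D).support : Set t.top) ∩ (t.transformMarked ⟨I, E, b⟩).support = ∅ :=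
  exists_separate_boundary_aux k p E.length X (X ↘ Spec (.of k)) hX2 I E E hb hbp hE (fun _ h => h) le_rfl

end Kollar2007

end Literature.AlgebraicGeometry.Resolution

end
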